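import Summits.Ventures.PercRepro.MSTheoremS
import Summits.Ventures.PercRepro.MSTightDichotomy

/-!
# The up–down inequality for tight families, and the comparability theorem

Dossier proofs/MINE1-theoremS.md, Addendum 52. For families `P`, `T` write
`↓T ∩ P = {p ∈ P : p ⊆ t for some t ∈ T}` and `↑T ∩ P = {p ∈ P : t ⊆ p for some t ∈ T}`.
Every difference `a ∖ b` with `a ∈ ↓T ∩ P`, `b ∈ ↑T ∩ P` lies below a difference `t₁ ∖ t₂` of `T`,
and every difference `b ∖ a` is a difference of `P`; so Daykin's inequality
`|A|·|B| ≤ |A \\ B|·|B \\ A|` (Mathlib `Finset.le_card_diffs_mul_card_diffs`) gives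
**`|↓T ∩ P| · |↑T ∩ P| ≤ |D(T)| · |D(P)|` whenever `D(T)` is a down-set**
(`card_down_mul_card_up_le`), hence **`≤ |T| · |P|` for tight `P` and tight `T`**
(`card_down_mul_card_up_le_of_tight`) — the opposite of the Harris–FKG direction for a down-set
and an up-set, forced here by tightness. `D(T)` is a down-set for every tight twin-free `T`
(`isDownSet_diffs_of_tight_of_twinFree`: the singletons are differences, Theorem S's atoms, and
`D(T)` is difference-closed). **Comparability theorem** (`down_eq_or_up_eq_of_cover`): if
moreover `T ⊆ P` and every member of `P` is comparable to some member of `T`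
(`P ⊆ ↓T ∪ ↑T`), then `↓T ∩ P = T` or `↑T ∩ P = T` — `T` is a down-set or an up-set of `P`
(counting: `|↓T ∩ P| + |↑T ∩ P| ≥ |P| + |T|` against the product bound). Census twin
(mining/mine-1/g28/tineq.c, tineq2.c, tineq3.py, tsub3.c): the inequality on all 717 tight
families of [4] with all 15,819 tight twin-free subfamilies and on 35,700 pairs of [5], the
comparability theorem on 1,780 / 1,780 covering pairs of [5] — 0 violations; twins in `T` break
both (`T = {∅, univ}`). This is the engine of the TightExt half (i) of the local dichotomy
(Addendum 52 §3).
-/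

namespace PercRepro.MSTight

open Finset
open scoped FinsetFamily

variable {α : Type*} [DecidableEq α]

/-- The members of `P` below some member of `T`: `↓T ∩ P`. -/
def downIn (P T : Finset (Finset α)) : Finset (Finset α) := P.filter fun p => ∃ t ∈ T, p ⊆ t

/-- The members of `P` above some member of `T`: `↑T ∩ P`. -/
def upIn (P T : Finset (Finset α)) : Finset (Finset α) := P.filter fun p => ∃ t ∈ T, t ⊆ p

/-- Membership in `↓T ∩ P`. -/
theorem mem_downIn {P T : Finset (Finset α)} {p : Finset α} :
    p ∈ downIn P T ↔ p ∈ P ∧ ∃ t ∈ T, p ⊆ t := by simp [downIn]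

/-- Membership in `↑T ∩ P`. -/
theorem mem_upIn {P T : Finset (Finset α)} {p : Finset α} :
    p ∈ upIn P T ↔ p ∈ P ∧ ∃ t ∈ T, t ⊆ p := by simp [upIn]

/-- `↓T ∩ P ⊆ P`. -/
theorem downIn_subset (P T : Finset (Finset α)) : downIn P T ⊆ P := filter_subset _ _

/-- `↑T ∩ P ⊆ P`. -/
theorem upIn_subset (P T : Finset (Finset α)) : upIn P T ⊆ P := filter_subset _ _

/-- `T ⊆ ↓T ∩ P` when `T ⊆ P`. -/
theorem subset_downIn {P T : Finset (Finset α)} (hTP : T ⊆ P) : T ⊆ downIn P T :=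
  fun t ht => mem_downIn.2 ⟨hTP ht, t, ht, subset_refl t⟩

/-- `T ⊆ ↑T ∩ P` when `T ⊆ P`. -/
theorem subset_upIn {P T : Finset (Finset α)} (hTP : T ⊆ P) : T ⊆ upIn P T :=
  fun t ht => mem_upIn.2 ⟨hTP ht, t, ht, subset_refl t⟩

/-- A difference of a member below `T` against a member above `T` is a difference of `T`, when
`D(T)` is a down-set. -/
theorem diffs_downIn_upIn_subset {P T : Finset (Finset α)} (hD : IsDownSet (T \\ T)) :
    downIn P T \\ upIn P T ⊆ T \\ T := by
  intro w hw
  obtain ⟨a, ha, b, hb, rfl⟩ := mem_diffs.1 hw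
  obtain ⟨-, t₁, ht₁, hat⟩ := mem_downIn.1 ha
  obtain ⟨-, t₂, ht₂, htb⟩ := mem_upIn.1 hb
  exact hD (t₁ \ t₂) (mem_diffs.2 ⟨t₁, ht₁, t₂, ht₂, rfl⟩) (a \ b) (sdiff_subset_sdiff hat htb)

/-- A difference of two members of `P` is a difference of `P`. -/
theorem diffs_upIn_downIn_subset (P T : Finset (Finset α)) :
    upIn P T \\ downIn P T ⊆ P \\ P :=
  diffs_subset (upIn_subset P T) (downIn_subset P T)

/-- **The up–down inequality.** `|↓T ∩ P| · |↑T ∩ P| ≤ |D(T)| · |D(P)|` when `D(T)` is a down-set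
(Daykin's inequality on the pair `(↓T ∩ P, ↑T ∩ P)`). -/
theorem card_down_mul_card_up_le {P T : Finset (Finset α)} (hD : IsDownSet (T \\ T)) :
    (downIn P T).card * (upIn P T).card ≤ (T \\ T).card * (P \\ P).card :=
  (Finset.le_card_diffs_mul_card_diffs _ _).trans
    (Nat.mul_le_mul (card_le_card (diffs_downIn_upIn_subset hD))
      (card_le_card (diffs_upIn_downIn_subset P T)))

/-- **The up–down inequality for tight families.** `|↓T ∩ P| · |↑T ∩ P| ≤ |T| · |P|` for tight
`P`, tight `T` with `D(T)` a down-set. -/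
theorem card_down_mul_card_up_le_of_tight {P T : Finset (Finset α)} (hP : Tight P) (hT : Tight T)
    (hD : IsDownSet (T \\ T)) : (downIn P T).card * (upIn P T).card ≤ T.card * P.card := by
  have h := card_down_mul_card_up_le (P := P) hD
  unfold Tight at hP hT
  rwa [hP, hT] at h

/-- **The comparability theorem.** If `T ⊆ P` are tight, `D(T)` is a down-set and every member
of `P` is comparable to some member of `T`, then `↓T ∩ P = T` or `↑T ∩ P = T`: `T` is a down-set
or an up-set of `P`. -/
theorem down_eq_or_up_eq_of_cover {P T : Finset (Finset α)} (hP : Tight P) (hT : Tight T)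
    (hD : IsDownSet (T \\ T)) (hTP : T ⊆ P)
    (hcov : ∀ p ∈ P, (∃ t ∈ T, p ⊆ t) ∨ (∃ t ∈ T, t ⊆ p)) :
    downIn P T = T ∨ upIn P T = T := by
  have hprod := card_down_mul_card_up_le_of_tight hP hT hD
  have hunion : downIn P T ∪ upIn P T = P := by
    apply Subset.antisymm (union_subset (downIn_subset P T) (upIn_subset P T))
    intro p hp
    rcases hcov p hp with h | h
    · exact mem_union.2 (Or.inl (mem_downIn.2 ⟨hp, h⟩))
    · exact mem_union.2 (Or.inr (mem_upIn.2 ⟨hp, h⟩))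
  have hinter : T ⊆ downIn P T ∩ upIn P T :=
    subset_inter (subset_downIn hTP) (subset_upIn hTP)
  have hsum : P.card + T.card ≤ (downIn P T).card + (upIn P T).card := by
    rw [← card_union_add_card_inter (downIn P T) (upIn P T), hunion]
    exact Nat.add_le_add_left (card_le_card hinter) _
  by_contra hcon
  push Not at hcon
  have hd : T.card < (downIn P T).card :=
    lt_of_le_of_ne (card_le_card (subset_downIn hTP))
      (fun h => hcon.1 (eq_of_subset_of_card_le (subset_downIn hTP) h.ge).symm)
  have hu : T.card < (upIn P T).card :=
    lt_of_le_of_ne (card_le_card (subset_upIn hTP))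
      (fun h => hcon.2 (eq_of_subset_of_card_le (subset_upIn hTP) h.ge).symm)
  nlinarith

variable [Fintype α]

/-- In a twin-free family every twin class is a singleton. -/
theorem cls_eq_singleton_of_twinFree {T : Finset (Finset α)} (htf : ∀ a b, Twin T a b → a = b)
    (a : α) : cls T a = {a} := by
  ext b
  rw [mem_cls, mem_singleton]
  exact ⟨fun h => (htf a b h).symm, fun h => h ▸ twin_refl T a⟩

/-- In a tight twin-free family every element of a difference is a singleton difference. -/
theorem singleton_mem_diffs_of_tight_of_twinFree {T : Finset (Finset α)} (hT : Tight T)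
    (htf : ∀ a b, Twin T a b → a = b) {w : Finset α} (hw : w ∈ T \\ T) {a : α} (ha : a ∈ w) :
    ({a} : Finset α) ∈ T \\ T := by
  obtain ⟨t₁, ht₁, t₀, ht₀, rfl⟩ := mem_diffs.1 hw
  rw [← cls_eq_singleton_of_twinFree htf a]
  exact cls_mem_diffs_of_tight hT ht₁ (mem_sdiff.1 ha).1 ht₀ (mem_sdiff.1 ha).2

/-- In a tight twin-free family, removing any set from a difference gives a difference. -/
theorem sdiff_mem_diffs_of_tight_of_twinFree {T : Finset (Finset α)} (hT : Tight T)
    (htf : ∀ a b, Twin T a b → a = b) {w : Finset α} (hw : w ∈ T \\ T) (S : Finset α) :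
    w \ S ∈ T \\ T := by
  induction S using Finset.induction_on with
  | empty => simpa using hw
  | insert a S haS ih =>
    by_cases haw : a ∈ w \ S
    · have h1 : w \ insert a S = (w \ S) \ {a} := by
        ext x
        simp only [mem_sdiff, mem_insert, mem_singleton]
        tauto
      rw [h1, ← diffs_diffs_eq_of_tight hT]
      exact mem_diffs.2 ⟨w \ S, ih, {a},
        singleton_mem_diffs_of_tight_of_twinFree hT htf ih haw, rfl⟩
    · have h1 : w \ insert a S = w \ S := by
        ext x
        simp only [mem_sdiff, mem_insert]
        constructor
        · rintro ⟨hx, hx'⟩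
          exact ⟨hx, fun h => hx' (Or.inr h)⟩
        · rintro ⟨hx, hx'⟩
          refine ⟨hx, ?_⟩
          rintro (rfl | h)
          · exact haw (mem_sdiff.2 ⟨hx, hx'⟩)
          · exact hx' h
      rw [h1]
      exact ih

/-- **`D(T)` is a down-set for every tight twin-free `T`.** -/
theorem isDownSet_diffs_of_tight_of_twinFree {T : Finset (Finset α)} (hT : Tight T)
    (htf : ∀ a b, Twin T a b → a = b) : IsDownSet (T \\ T) := by
  intro w hw w' hw'
  have : w' = w \ (w \ w') := by
    ext x
    simp only [mem_sdiff]
    constructor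
    · intro hx
      exact ⟨hw' hx, fun h => h.2 hx⟩
    · rintro ⟨hx, hx'⟩
      by_contra h
      exact hx' ⟨hx, h⟩
  rw [this]
  exact sdiff_mem_diffs_of_tight_of_twinFree hT htf hw _

/-- The up–down inequality for a tight `P` and a tight twin-free `T`. -/
theorem card_down_mul_card_up_le_of_tight_of_twinFree {P T : Finset (Finset α)} (hP : Tight P)
    (hT : Tight T) (htf : ∀ a b, Twin T a b → a = b) :
    (downIn P T).card * (upIn P T).card ≤ T.card * P.card :=
  card_down_mul_card_up_le_of_tight hP hT (isDownSet_diffs_of_tight_of_twinFree hT htf)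

/-- The comparability theorem for a tight `P` and a tight twin-free `T ⊆ P`. -/
theorem down_eq_or_up_eq_of_cover_of_twinFree {P T : Finset (Finset α)} (hP : Tight P)
    (hT : Tight T) (htf : ∀ a b, Twin T a b → a = b) (hTP : T ⊆ P)
    (hcov : ∀ p ∈ P, (∃ t ∈ T, p ⊆ t) ∨ (∃ t ∈ T, t ⊆ p)) :
    downIn P T = T ∨ upIn P T = T :=
  down_eq_or_up_eq_of_cover hP hT (isDownSet_diffs_of_tight_of_twinFree hT htf) hTP hcov

end PercRepro.MSTight
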